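import Literature.NumberTheory.Automorphic.RankinSelbergTorusIntegral
import HarnessLib

/-!
# Unfolding an integral over the adelic torus one place at a time:
`∫_{B(G)} f = (Σ_μ c_μ) · ∫_{B(insert v G)} f` for an integrand scaling under `ϖ_v^μ`
(Jacquet–Shalika (1981), §2, §4; Cogdell (2004), §2.3: the Euler factorisation of torus integrals)

Topic `NumberTheory/Automorphic`; namespace `Literature.NumberTheory.Automorphic`. Proof file
(theorems only). The "translate trick" of `RankinSelbergTorusIntegral` (`setLIntegral_smul_unitBox_eq`,
`schurSelfSum_mul_setLIntegral_le`: the translates `ϖ_v^μ B(insert v G)`, `μ ∈ ℕⁿ`, of the unit box are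
disjoint subsets of `B(G)`), made into an EQUALITY for a general non-negative integrand and supplemented
by the exhaustion of the `v`-integral part of `B(G)` by these translates:

* `setLIntegral_smul_torus_eq` — `∫_{t • B} f dν = ∫_B f(t a) dν(a)` for a left-invariant measure `ν` on the
  torus `(𝔸_Kˣ)ⁿ`;
* `exists_mem_smul_unitBox_of_valued_le_one` — a point of `B(G)` all of whose entries have
  `v`-valuation `≤ 1` lies in some translate `ϖ_v^μ B(insert v G)` (`μ_i = -log |a_i|_v`);
* `setLIntegral_unitBox_eq_tsum_mul` (**main**) — for `v ∉ G`, a uniformizer `ϖ` at `v`, a measurable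
  `f ≥ 0` which VANISHES at the points of `B(G)` having an entry of `v`-valuation `> 1` and SCALES on the
  translates, `f(ϖ_v^μ a) = c_μ f(a)` for `a ∈ B(insert v G)`:

    `∫_{B(G)} f dν = (Σ_μ c_μ) · ∫_{B(insert v G)} f dν`.

This is the form in which a torus integral of a factorizable majorant is peeled off one unramified
place at a time with an explicit local factor `Σ_μ c_μ` (e.g. `∏_i (1 - q_v^{-e_i})⁻¹` for
`c_μ = ∏_i q_v^{-μ_i e_i}`), the step of the absolute convergence of unfolded Rankin–Selberg integrals
"for `Re(s) ≫ 0` by the gauge estimates" (Cogdell (2004), §2.3).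

## References

* H. Jacquet, J. A. Shalika, *On Euler products and the classification of automorphic
  representations I*, Amer. J. Math. 103 (1981), §2, §4 [JacquetShalikaAJM1981].
* J. W. Cogdell, *Analytic theory of L-functions for GL_n* (2004), §2.3 [CogdellAnalyticTheory2004].
-/

noncomputable section

open MeasureTheory Measure NumberField IsDedekindDomain Set Filter Topology
open Literature.NumberTheory.GaloisRepresentations (ideleGroup localUnits)
open scoped ENNReal NNReal Pointwise

namespace Literature.NumberTheory.Automorphic

section Translate

variable {n : ℕ} {K : Type} [Field K] [NumberField K]
variable [MeasurableSpace (ideleGroup K)] [BorelSpace (ideleGroup K)]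

attribute [local instance] secondCountableTopology_ideleGroup

variable (νA : Measure (Fin n → ideleGroup K)) [νA.IsMulLeftInvariant]

/-- **`∫_{t • B} f dν = ∫_B f(t a) dν(a)`** for a left-invariant measure on the torus `(𝔸_Kˣ)ⁿ`. [folklore] -/
theorem setLIntegral_smul_torus_eq (t : Fin n → ideleGroup K) (B : Set (Fin n → ideleGroup K))
    (f : (Fin n → ideleGroup K) → ℝ≥0∞) :
    ∫⁻ a in t • B, f a ∂νA = ∫⁻ a in B, f (t * a) ∂νA := by
  have hmp : MeasurePreserving (MeasurableEquiv.mulLeft t) νA νA := measurePreserving_mul_left νA t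
  have hpre : (MeasurableEquiv.mulLeft t) ⁻¹' (t • B) = B := by
    ext a
    simp only [MeasurableEquiv.coe_mulLeft, Set.mem_preimage]
    exact Set.smul_mem_smul_set_iff
  calc ∫⁻ a in t • B, f a ∂νA
      = ∫⁻ a in (MeasurableEquiv.mulLeft t) ⁻¹' (t • B), f (MeasurableEquiv.mulLeft t a) ∂νA :=
        (hmp.setLIntegral_comp_preimage_emb (MeasurableEquiv.mulLeft t).measurableEmbedding _ _).symm
    _ = ∫⁻ a in B, f (t * a) ∂νA := by rw [hpre]; rfl

variable {v : HeightOneSpectrum (𝓞 K)} {ϖ : (v.adicCompletion K)ˣ}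

omit [MeasurableSpace (ideleGroup K)] [BorelSpace (ideleGroup K)] in
/-- **Exhaustion of the `v`-integral part of `B(G)` by the translates `ϖ_v^μ B(insert v G)`**: if all
entries of `a ∈ B(G)` have `v`-valuation `≤ 1`, then `a = ϖ_v^μ b` with `b ∈ B(insert v G)`,
`μ_i = -log_{q_v} |a_i|_v`. [folklore] -/
theorem exists_mem_smul_unitBox_of_valued_le_one
    (hϖ : Valued.v (ϖ : v.adicCompletion K) = WithZero.exp (-1 : ℤ))
    {G : Set (HeightOneSpectrum (𝓞 K))} {a : Fin n → ideleGroup K} (ha : a ∈ unitBox (n := n) (K := K) G)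
    (hle : ∀ i, Valued.v (((a i : ideleGroup K) : AdeleRing (𝓞 K) K).2 v) ≤ 1) :
    ∃ mu : Fin n → ℕ, a ∈ localTorusPow ϖ mu • unitBox (n := n) (K := K) (insert v G) := by
  -- the exponents
  have hk : ∀ i, ∃ k : ℕ, Valued.v (((a i : ideleGroup K) : AdeleRing (𝓞 K) K).2 v) = WithZero.exp (-(k : ℤ)) := by
    intro i
    set y := Valued.v (((a i : ideleGroup K) : AdeleRing (𝓞 K) K).2 v) with hy
    have hy0 : y ≠ 0 := (Valuation.ne_zero_iff _).2 (idele_snd_apply_ne_zero (a i) v)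
    have hlog : y = WithZero.exp (WithZero.log y) := (WithZero.exp_log hy0).symm
    have hle0 : WithZero.log y ≤ 0 := by
      have h := hle i
      rw [← hy, hlog, ← WithZero.exp_zero, WithZero.exp_le_exp] at h
      exact h
    refine ⟨(-WithZero.log y).toNat, ?_⟩
    rw [Int.toNat_of_nonneg (by omega), neg_neg]
    exact hlog
  choose mu hmu using hk
  refine ⟨mu, ?_⟩
  -- the unit part `b = ϖ^{-μ} a`
  set b : Fin n → ideleGroup K := fun i => localUnits v ((ϖ ^ mu i)⁻¹) * a i with hb
  have hab : localTorusPow ϖ mu * b = a := by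
    funext i
    simp only [Pi.mul_apply, hb, localTorusPow]
    rw [← mul_assoc, ← map_mul, mul_inv_cancel, map_one, one_mul]
  refine ⟨b, ?_, hab⟩
  -- `b ∈ B(insert v G)`
  intro w hw i
  have hcomp : ((b i : ideleGroup K) : AdeleRing (𝓞 K) K).2 w =
      ((localUnits v ((ϖ ^ mu i)⁻¹) : ideleGroup K) : AdeleRing (𝓞 K) K).2 w *
        ((a i : ideleGroup K) : AdeleRing (𝓞 K) K).2 w := by
    simp only [hb, Units.val_mul]
    rfl
  by_cases hwv : w = v
  · subst hwv
    rw [hcomp, Literature.NumberTheory.GaloisRepresentations.localUnits_snd_apply_self, map_mul,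
      hmu i, Units.val_inv_eq_inv_val, map_inv₀, Units.val_pow_eq_pow_val, map_pow, hϖ,
      ← WithZero.exp_nsmul, ← WithZero.exp_neg, ← WithZero.exp_add]
    simp
  · have hwG : w ∈ G := (Set.mem_insert_iff.1 hw).resolve_left hwv
    have h1 : ((localUnits v ((ϖ ^ mu i)⁻¹) : ideleGroup K) : AdeleRing (𝓞 K) K).2 w = 1 := by
      change (GaloisRepresentations.finiteAdeleSingle v _) w = 1
      exact GaloisRepresentations.finiteAdeleSingle_apply_of_ne _ hwv
    rw [hcomp, h1, one_mul]
    exact ha w hwG i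

/-- **Unfolding one place.** For `v ∉ G`, a uniformizer `ϖ` at `v`, a measurable `f ≥ 0` on the torus
which vanishes at the points of `B(G)` having an entry of `v`-valuation `> 1` and satisfies
`f(ϖ_v^μ a) = c_μ f(a)` for `a ∈ B(insert v G)`, and a left-invariant measure `ν`:
`∫_{B(G)} f dν = (Σ_μ c_μ) ∫_{B(insert v G)} f dν`. [folklore] -/
theorem setLIntegral_unitBox_eq_tsum_mul
    (hϖ : Valued.v (ϖ : v.adicCompletion K) = WithZero.exp (-1 : ℤ))
    {G : Set (HeightOneSpectrum (𝓞 K))} (hv : v ∉ G)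
    {f : (Fin n → ideleGroup K) → ℝ≥0∞} (hf : Measurable f) (c : (Fin n → ℕ) → ℝ≥0∞)
    (hscale : ∀ (mu : Fin n → ℕ), ∀ a ∈ unitBox (n := n) (K := K) (insert v G),
      f (localTorusPow ϖ mu * a) = c mu * f a)
    (hsupp : ∀ a ∈ unitBox (n := n) (K := K) G,
      (∃ i, 1 < Valued.v (((a i : ideleGroup K) : AdeleRing (𝓞 K) K).2 v)) → f a = 0) :
    ∫⁻ a in unitBox G, f a ∂νA = (∑' mu : Fin n → ℕ, c mu) * ∫⁻ a in unitBox (insert v G), f a ∂νA := by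
  set S : Set (Fin n → ideleGroup K) := ⋃ mu : Fin n → ℕ, localTorusPow ϖ mu • unitBox (n := n) (K := K) (insert v G)
    with hS
  have hSmeas : MeasurableSet S := MeasurableSet.iUnion fun mu => measurableSet_smul_unitBox _ _
  have hSsub : S ⊆ unitBox G := Set.iUnion_subset fun mu => localTorusPow_smul_unitBox_subset hv mu
  -- `f = 1_S f` on `B(G)`
  have hind : ∀ a ∈ unitBox (n := n) (K := K) G, f a = S.indicator f a := by
    intro a ha
    by_cases haS : a ∈ S
    · rw [Set.indicator_of_mem haS]
    · rw [Set.indicator_of_notMem haS]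
      refine hsupp a ha ?_
      by_contra hno
      push Not at hno
      obtain ⟨mu, hmu⟩ := exists_mem_smul_unitBox_of_valued_le_one hϖ ha hno
      exact haS (Set.mem_iUnion.2 ⟨mu, hmu⟩)
  rw [setLIntegral_congr_fun (measurableSet_unitBox G) hind, lintegral_indicator hSmeas,
    Measure.restrict_restrict hSmeas, Set.inter_eq_left.2 hSsub, hS,
    lintegral_iUnion (fun mu => measurableSet_smul_unitBox _ _)
      (pairwise_disjoint_localTorusPow_smul_unitBox hϖ G)]
  have hterm : ∀ mu : Fin n → ℕ,
      ∫⁻ a in localTorusPow ϖ mu • unitBox (n := n) (K := K) (insert v G), f a ∂νA =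
        c mu * ∫⁻ a in unitBox (insert v G), f a ∂νA := by
    intro mu
    rw [setLIntegral_smul_torus_eq νA _ _, ← lintegral_const_mul _ hf]
    exact setLIntegral_congr_fun (measurableSet_unitBox _) fun a ha => hscale mu a ha
  simp_rw [hterm]
  rw [ENNReal.tsum_mul_right]

end Translate

end Literature.NumberTheory.Automorphic
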